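import Mathlib

/-!
# The twelve-edge Kronecker certificate of the typed `K₃` base on `K₅ + a₃` of degree 2, pair `{a₁, a₂}`
(blind cell PercRepro2, mine-2 g26; the pair where `a₃` joins the two ROOTS, so the event `Q = {a₁ ↮ a₂}` itself depends on both new edges; typer-1's `K5Kernel` / `K5K3Kernel`
shape one edge-pair up; census M2-60, kit j258912, two own codes digit for digit)

The graph: `K₅` on `o = 0, a₁ = 1, a₂ = 2, u = 3, b = 4` (edges `0..9`, lexicographic pairs) plus the vertex
`a₃ = 5` joined to `a₁` (edge `10`) and to `a₂` (edge `11`).  Configurations `ω : Fin 12 → Bool`; connectivity on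
vertex bitmasks (`nb`, `step`, `reach` — five closure steps on six vertices — `conn`), all kernel-accelerated
(`Nat.testBit` / `Nat.lor` / `Nat.shiftLeft`).  The marks of the crux functional are `o = 0, a₁ = 1, a₂ = 2,
a₃ = 5, b = 4`.

p1's eight-term kernel `K₃ = f₂f₁f₄ + f₁f₃f₅ − f₂f₁f₆ − f₂f₇f₈ − f₃f₇f₉ + f₂f₇f₁₀ − f₂f₁f₁₁ + f₁f₁₂f₃`
(`CovForm.K3`, `HCovCubic.lean`; `f₁ = 1_Q`, `f₂ = 1_PD`, `f₃ = 1_PD 1_{o∈U}`, `f₄ = 1_Q σ_o σ_b`, `f₅ = 1_Q σ₃ σ_b`,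
`f₆ = 1_Q σ₃ 1_{o∈U} σ_b`, `f₇ = 1_Q σ_b`, `f₈ = 1_Q σ_o`, `f₉ = 1_Q σ₃`, `f₁₀ = 1_Q σ₃ 1_{o∈U}`,
`f₁₁ = 1_PD 1_{o∈U} 1_{b∈U}`, `f₁₂ = 1_PD 1_{b∈U}`, `σ_v = 1_{v∈C₁} − 1_{v∈C₂}`) splits on `Q = {a₁ ↮ a₂}` into
ten positive and ten negative products of three `0/1` tables exactly as in `K5K3Kernel.lean`, the tables now
read on the six-vertex graph.

**Kronecker substitution.** `kron T = Σ_ω [T ω] · KB^{idx ω}`, `idx ω = Σ_e ω_e 4^e`, `KB = 2^24` (computed by the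
edge-tree recursion `go`); a product of three encodings carries, digit by digit (base `KB`, digit `Σ_e k_e 4^e`
for the profile `k ∈ {0,1,2,3}^12`), the typed three-copy class sums `Σ_{ω¹+ω²+ω³ = k} T₁(ω¹) T₂(ω²) T₃(ω³)`
(`K5Kron.kronSum_mul_mul`, the same identity on `Fin 12`: the indices add without carries); a digit is a sum of ten
counts, each `≤ 3^12`, so `< 10 · 3^12 < 2^23`.

**The certificate** (`cert`, one `decide +kernel`): `kNeg ≤ kPos`, `Nat.land (kPos − kNeg) mask = 0`,
`Nat.land kNeg mask = 0` (`mask` = bit `23` of every base-`KB` digit below `4^12`): the digits of `kNeg` and of the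
difference are below `2^23`, so the subtraction borrowed nowhere — `kPos ≥ kNeg` DIGITWISE: every typed
three-copy class sum of `K₃` on `K₅ + {a₃a₁, a₃a₂}` is `≥ 0`, i.e. row 2′TRI (`CovForm.TypedBases`) on this
twelve-edge skeleton, every typed edge set and pinning at once.  No `native_decide`, no data file: the kernel
computes the tables, the twenty products and the masks itself.  The census twin (mine-2 g26, kit j258912, two own
codes): 161,646 positive digits, 16,615,570 zeros, max digit 4,272; the C/GMP twin of these three numbers
(`certcheck.c`, mining/mine-2/code/g26/) confirms the three conditions and that the digits of `kPos − kNeg` are the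
class sums.  The bridge from these `ℕ` facts to `typedCount` on the twelve-edge graph (the port of `K5Kron` /
`K5TypedK3` / `K5TypedK3Marks` to `Fin 12`) is not in this file.
-/

namespace Summit.Ventures.PercRepro2

namespace Deg2A1A2

/-! ## The graph `K₅ + {a₃a₁, a₃a₂}` and bitmask connectivity on six vertices -/

/-- First endpoint of edge `e` (lexicographic pairs of `K₅`, then `a₃a₁`, `a₃a₂`). -/
def ea : Fin 12 → ℕ
  | 0 => 0 | 1 => 0 | 2 => 0 | 3 => 0 | 4 => 1 | 5 => 1 | 6 => 1 | 7 => 2 | 8 => 2 | 9 => 3 | 10 => 1 | 11 => 2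

/-- Second endpoint of edge `e`. -/
def eb : Fin 12 → ℕ
  | 0 => 1 | 1 => 2 | 2 => 3 | 3 => 4 | 4 => 2 | 5 => 3 | 6 => 4 | 7 => 3 | 8 => 4 | 9 => 4 | 10 => 5 | 11 => 5

/-- The neighbour bitmask of the vertex `u` in the open subgraph of `ω`. -/
def nb (ω : Fin 12 → Bool) (u : ℕ) : ℕ :=
  (List.finRange 12).foldl (fun acc e =>
    if ω e then
      (if ea e = u then acc ||| (1 <<< eb e) else if eb e = u then acc ||| (1 <<< ea e) else acc)
    else acc) 0

/-- One closure step on a vertex bitmask: add the open neighbours of every vertex of `R`. -/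
def step (ω : Fin 12 → Bool) (R : ℕ) : ℕ :=
  (List.range 6).foldl (fun acc v => if R.testBit v then acc ||| nb ω v else acc) R

/-- The vertices reached from `u` (five steps suffice on six vertices). -/
def reach (ω : Fin 12 → Bool) (u : ℕ) : ℕ := step ω (step ω (step ω (step ω (step ω (1 <<< u)))))

/-- Computable connectivity `u ↔ v` in the open subgraph of `ω`. -/
def conn (ω : Fin 12 → Bool) (u v : ℕ) : Bool := (reach ω u).testBit v

/-! ## The side tables (marks `o = 0, a₁ = 1, a₂ = 2, a₃ = 5, b = 4`) -/

/-- `Q = {a₁ ↮ a₂}`. -/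
def tQ (ω : Fin 12 → Bool) : Bool := !conn ω 1 2
/-- `L_v = {v ∈ C₁}`: `v` joined to `a₁ = 1`. -/
def tL (v : ℕ) (ω : Fin 12 → Bool) : Bool := conn ω 1 v
/-- `H_v = {v ∈ C₂}`: `v` joined to `a₂ = 2`. -/
def tH (v : ℕ) (ω : Fin 12 → Bool) : Bool := conn ω 2 v
/-- `U_v = {v ∈ C₁ ∪ C₂}`. -/
def tU (v : ℕ) (ω : Fin 12 → Bool) : Bool := tL v ω || tH v ω
/-- `u` and `v` on the same side: the positive part of `σ_u σ_v`. -/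
def tSame (u v : ℕ) (ω : Fin 12 → Bool) : Bool := (tL u ω && tL v ω) || (tH u ω && tH v ω)
/-- `u` and `v` on opposite sides: the negative part of `σ_u σ_v`. -/
def tOpp (u v : ℕ) (ω : Fin 12 → Bool) : Bool := (tL u ω && tH v ω) || (tH u ω && tL v ω)
/-- `PD = Q ∩ {a₃ ∉ C₁ ∪ C₂}`. -/
def tPD (ω : Fin 12 → Bool) : Bool := tQ ω && !tL 5 ω && !tH 5 ω
/-- `PD ∩ {o ∈ C₁ ∪ C₂}` (`f₃`). -/
def tPDoU (ω : Fin 12 → Bool) : Bool := tPD ω && tU 0 ω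

/-! ## The tables of the twelve functions -/

/-- `f₄⁺ = 1_Q 1_{o, b same side}`. -/
def t4p (ω : Fin 12 → Bool) : Bool := tQ ω && tSame 0 4 ω
/-- `f₄⁻ = 1_Q 1_{o, b opposite}`. -/
def t4m (ω : Fin 12 → Bool) : Bool := tQ ω && tOpp 0 4 ω
/-- `f₅⁺ = 1_Q 1_{a₃, b same side}`. -/
def t5p (ω : Fin 12 → Bool) : Bool := tQ ω && tSame 5 4 ω
/-- `f₅⁻ = 1_Q 1_{a₃, b opposite}`. -/
def t5m (ω : Fin 12 → Bool) : Bool := tQ ω && tOpp 5 4 ω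
/-- `f₆⁺ = 1_Q 1_{o∈U} 1_{a₃, b same side}`. -/
def t6p (ω : Fin 12 → Bool) : Bool := tQ ω && tU 0 ω && tSame 5 4 ω
/-- `f₆⁻ = 1_Q 1_{o∈U} 1_{a₃, b opposite}`. -/
def t6m (ω : Fin 12 → Bool) : Bool := tQ ω && tU 0 ω && tOpp 5 4 ω
/-- `f₇⁺` at `v`: `1_Q 1_{v∈C₁}` (`f₇` at `b = 4`, `f₈` at `o = 0`, `f₉` at `a₃ = 5`). -/
def t7p (v : ℕ) (ω : Fin 12 → Bool) : Bool := tQ ω && tL v ω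
/-- `f₇⁻` at `v`: `1_Q 1_{v∈C₂}`. -/
def t7m (v : ℕ) (ω : Fin 12 → Bool) : Bool := tQ ω && tH v ω
/-- `f₁₀⁺ = 1_Q 1_{a₃∈C₁} 1_{o∈U}`. -/
def t10p (ω : Fin 12 → Bool) : Bool := tQ ω && tL 5 ω && tU 0 ω
/-- `f₁₀⁻ = 1_Q 1_{a₃∈C₂} 1_{o∈U}`. -/
def t10m (ω : Fin 12 → Bool) : Bool := tQ ω && tH 5 ω && tU 0 ω
/-- `f₁₁ = 1_PD 1_{o∈U} 1_{b∈U}`. -/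
def t11 (ω : Fin 12 → Bool) : Bool := tPD ω && tU 0 ω && tU 4 ω
/-- `f₁₂ = 1_PD 1_{b∈U}`. -/
def t12 (ω : Fin 12 → Bool) : Bool := tPD ω && tU 4 ω

/-! ## Kronecker numbers and the certificate -/

/-- The base-4 index of a configuration: digit `e` is the state of edge `e`. -/
def idx (ω : Fin 12 → Bool) : ℕ := ∑ e, (ω e).toNat * 4 ^ (e : ℕ)

/-- The Kronecker base `2^24` (digits are `< 10 · 3^12 < 2^23`). -/
def KB : ℕ := 2 ^ 24

/-- The Kronecker encoding of a Boolean table on the configurations, as a finite sum. -/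
def kronSum (T : (Fin 12 → Bool) → Bool) : ℕ := ∑ ω, (T ω).toNat * KB ^ idx ω

/-- The same number by a binary tree over the edges `11, 10, …, 0` (`go T n ω` sums over the states of the
edges `< n`, the others fixed by `ω`): `go T (n+1) ω = go T n ω[n ↦ 0] + KB^{4^n} · go T n ω[n ↦ 1]`. -/
def go (T : (Fin 12 → Bool) → Bool) : ℕ → (Fin 12 → Bool) → ℕ
  | 0, ω => (T ω).toNat
  | n + 1, ω => go T n (Function.update ω (Fin.ofNat 12 n) false) +
      KB ^ (4 ^ n) * go T n (Function.update ω (Fin.ofNat 12 n) true)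

/-- The Kronecker encoding, kernel form: `kron T = go T 12 (fun _ => false)`. -/
def kron (T : (Fin 12 → Bool) → Bool) : ℕ := go T 12 (fun _ => false)

/-- The positive part of `K₃` on `K₅ + {a₃a₁, a₃a₂}` (ten products, in the order `x, y, w` of the factors):
`f₂f₁f₄⁺ + f₁f₃f₅⁺ + f₂f₁f₆⁻ + f₂f₇⁺f₈⁻ + f₂f₇⁻f₈⁺ + f₃f₇⁺f₉⁻ + f₃f₇⁻f₉⁺ + f₂f₇⁺f₁₀⁺ + f₂f₇⁻f₁₀⁻ + f₁f₁₂f₃`. -/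
def kPos : ℕ :=
  kron tPD * kron tQ * kron t4p + kron tQ * kron tPDoU * kron t5p +
    kron tPD * kron tQ * kron t6m +
    kron tPD * kron (t7p 4) * kron (t7m 0) + kron tPD * kron (t7m 4) * kron (t7p 0) +
    kron tPDoU * kron (t7p 4) * kron (t7m 5) + kron tPDoU * kron (t7m 4) * kron (t7p 5) +
    kron tPD * kron (t7p 4) * kron t10p + kron tPD * kron (t7m 4) * kron t10m +
    kron tQ * kron t12 * kron tPDoU

/-- The negative part of `K₃` on `K₅ + {a₃a₁, a₃a₂}` (ten products):
`f₂f₁f₄⁻ + f₁f₃f₅⁻ + f₂f₁f₆⁺ + f₂f₇⁺f₈⁺ + f₂f₇⁻f₈⁻ + f₃f₇⁺f₉⁺ + f₃f₇⁻f₉⁻ + f₂f₇⁺f₁₀⁻ + f₂f₇⁻f₁₀⁺ + f₂f₁f₁₁`. -/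
def kNeg : ℕ :=
  kron tPD * kron tQ * kron t4m + kron tQ * kron tPDoU * kron t5m +
    kron tPD * kron tQ * kron t6p +
    kron tPD * kron (t7p 4) * kron (t7p 0) + kron tPD * kron (t7m 4) * kron (t7m 0) +
    kron tPDoU * kron (t7p 4) * kron (t7p 5) + kron tPDoU * kron (t7m 4) * kron (t7m 5) +
    kron tPD * kron (t7p 4) * kron t10m + kron tPD * kron (t7m 4) * kron t10p +
    kron tPD * kron tQ * kron t11

/-- The mask: bit `23` of every base-`KB` digit below `4^12`. -/
def mask : ℕ := 2 ^ 23 * ((KB ^ (4 ^ 12) - 1) / (KB - 1))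

/-- **The certificate shape**: `kNeg ≤ kPos` and the two mask tests (no borrow anywhere, digits of `kNeg`
below `2^23`). -/
def Cert : Prop := kNeg ≤ kPos ∧ Nat.land (kPos - kNeg) mask = 0 ∧ Nat.land kNeg mask = 0

set_option maxRecDepth 100000 in
/-- **The twelve-edge certificate of the typed `K₃` base on `K₅ + {a₃a₁, a₃a₂}`**, marks
`(o, a₁, a₂, a₃, b) = (0, 1, 2, 5, 4)`: every typed three-copy class sum is `≥ 0` (row 2′TRI on the first
non-leaf six-vertex family), by one `decide +kernel`. -/
theorem cert : Cert := by
  unfold Cert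
  decide +kernel

end Deg2A1A2

end Summit.Ventures.PercRepro2
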